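/-
Origin: expansion seat `planner-pub-hodgecm-pv10-0`, handover #5 2026-08-18T04:09:35Z (`HOME/pub-hodgecm-pv10/lean/Pv10/CharacterGluing.lean`, md5 acd0d12e, 202 lines);
landed by the gen-5 packager in gate run 21 as `HodgeCM/PerL34/CharacterGluing.lean` (import ^import Pv[0-9]+\.→import HodgeCM.PerL34. ×1).
-/
/-
Origin: planner-pub-hodgecm-pv10-0 (unit pub-hodgecm-pv10), HodgeCM publication cell, 2026-08-18.
Node N15 (PerL v5 §3.2, tex ll. 304–314): the character `χ_B` of `B = L^×𝔸_{L₀}^×L_∞^×/L^×` is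
"well defined by (∞) and (𝔣)" — the abstract gluing step, KERNEL; and its `C_K`-instance shape.
At landing `Pv10.InfinityType` → `HodgeCM.PerL34.InfinityType`.
-/
import Summits.HodgeConjecture.HodgeCM.PerL34.InfinityType

/-!
# Gluing characters on `H₁ ⊔ H₂` (node N15: well-definedness of `χ_B`)

* `Subgroup.exists_monoidHom_sup_extends` / `Subgroup.monoidHom_sup_ext`: in a commutative group,
  characters `χ₁ : H₁ →* M`, `χ₂ : H₂ →* M` (values in a commutative group) which AGREE on `H₁ ⊓ H₂`
  glue to a unique character of `H₁ ⊔ H₂` extending both.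
* `MonoidHom.exists_range_factor`: a character killing `ker f` factors through `f.range`.
* Instance shape over Mathlib's idele class group `C_K`:
  `NumberField.exists_char_sup_infUnits_of_compatible` — for ANY subgroup `H ≤ C_K`, character
  `χ₁ : H →* S¹` and ∞-type `e` with `χ₁ = (∞-type character e)` on `H ⊓ [K_∞^×]` (PerL's
  compatibility (∞)), there is a character `χ_B` of `B := H ⊔ [K_∞^×]` restricting to `χ₁` and to the
  ∞-type character; and `NumberField.exists_unitaryHeckeCharacter_of_compatible` — if that `χ_B` is
  continuous (in the application this is what PerL's (𝔣) delivers) it extends to a unitary Hecke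
  character of ∞-type `e` restricting to `χ₁` on `H`.

Not here: PerL's specific `H` = image of `C_{L₀}` in `C_L` (needs base change of adele rings along
`L/L₀`, absent from Mathlib) and the verification of (∞), (𝔣) for it — those remain INPUTS.
-/

set_option autoImplicit false

noncomputable section

/-! ## Factoring through the range -/

namespace MonoidHom

variable {G H M : Type*} [Group G] [Group H] [CommGroup M]

/-- A homomorphism that kills `ker f` factors through `f.range`. -/
theorem exists_range_factor (f : G →* H) (φ : G →* M) (hker : ∀ x, f x = 1 → φ x = 1) :
    ∃ χ : f.range →* M, ∀ x : G, χ ⟨f x, ⟨x, rfl⟩⟩ = φ x := by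
  classical
  -- well-definedness
  have wd : ∀ a b : G, f a = f b → φ a = φ b := by
    intro a b hab
    have h1 : f (a * b⁻¹) = 1 := by rw [map_mul, map_inv, hab, mul_inv_cancel]
    have h2 := hker _ h1
    rw [map_mul, map_inv, mul_inv_eq_one] at h2
    exact h2
  let pre : f.range → G := fun r => r.2.choose
  have hpre : ∀ r : f.range, f (pre r) = r := fun r => r.2.choose_spec
  refine ⟨{ toFun := fun r => φ (pre r), map_one' := ?_, map_mul' := ?_ }, ?_⟩
  · have : f (pre 1) = f 1 := by rw [hpre, map_one]; rfl
    rw [wd _ _ this, map_one]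
  · intro a b
    have : f (pre (a * b)) = f (pre a * pre b) := by
      rw [map_mul, hpre, hpre, hpre]; rfl
    show φ (pre (a * b)) = φ (pre a) * φ (pre b)
    rw [wd _ _ this, map_mul]
  · intro x
    show φ (pre ⟨f x, ⟨x, rfl⟩⟩) = φ x
    exact wd _ _ (hpre ⟨f x, ⟨x, rfl⟩⟩)

end MonoidHom

/-! ## Gluing on `H₁ ⊔ H₂` -/

namespace Subgroup

variable {G M : Type*} [CommGroup G] [CommGroup M] {H₁ H₂ : Subgroup G}

/-- Well-definedness of the glued value `χ₁ y · χ₂ z` for `x = y z`. -/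
theorem glue_wd (χ₁ : H₁ →* M) (χ₂ : H₂ →* M)
    (h : ∀ (x : G) (h1 : x ∈ H₁) (h2 : x ∈ H₂), χ₁ ⟨x, h1⟩ = χ₂ ⟨x, h2⟩)
    {y y' z z' : G} (hy : y ∈ H₁) (hy' : y' ∈ H₁) (hz : z ∈ H₂) (hz' : z' ∈ H₂)
    (heq : y * z = y' * z') :
    χ₁ ⟨y, hy⟩ * χ₂ ⟨z, hz⟩ = χ₁ ⟨y', hy'⟩ * χ₂ ⟨z', hz'⟩ := by
  have key : y'⁻¹ * y = z' * z⁻¹ := by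
    have e1 : y'⁻¹ * y = y'⁻¹ * (y * z) * z⁻¹ := by group
    rw [e1, heq]; group
  have ht1 : y'⁻¹ * y ∈ H₁ := mul_mem (inv_mem hy') hy
  have ht2 : y'⁻¹ * y ∈ H₂ := key ▸ mul_mem hz' (inv_mem hz)
  have hχ := h _ ht1 ht2
  have e2 : (⟨y'⁻¹ * y, ht1⟩ : H₁) = ⟨y', hy'⟩⁻¹ * ⟨y, hy⟩ := rfl
  have e3 : (⟨y'⁻¹ * y, ht2⟩ : H₂) = ⟨z', hz'⟩ * ⟨z, hz⟩⁻¹ := Subtype.ext key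
  rw [e2, e3, map_mul, map_inv, map_mul, map_inv] at hχ
  calc χ₁ ⟨y, hy⟩ * χ₂ ⟨z, hz⟩
      = χ₁ ⟨y', hy'⟩ * ((χ₁ ⟨y', hy'⟩)⁻¹ * χ₁ ⟨y, hy⟩) * χ₂ ⟨z, hz⟩ := by group
    _ = χ₁ ⟨y', hy'⟩ * (χ₂ ⟨z', hz'⟩ * (χ₂ ⟨z, hz⟩)⁻¹) * χ₂ ⟨z, hz⟩ := by rw [hχ]
    _ = χ₁ ⟨y', hy'⟩ * χ₂ ⟨z', hz'⟩ := by group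

/-- **Gluing.**  Characters of `H₁` and `H₂` that agree on `H₁ ⊓ H₂` extend to a character of
`H₁ ⊔ H₂`. -/
theorem exists_monoidHom_sup_extends (χ₁ : H₁ →* M) (χ₂ : H₂ →* M)
    (h : ∀ (x : G) (h1 : x ∈ H₁) (h2 : x ∈ H₂), χ₁ ⟨x, h1⟩ = χ₂ ⟨x, h2⟩) :
    ∃ χ : (H₁ ⊔ H₂ : Subgroup G) →* M,
      (∀ (x : G) (hx : x ∈ H₁), χ ⟨x, mem_sup_left hx⟩ = χ₁ ⟨x, hx⟩) ∧
      (∀ (x : G) (hx : x ∈ H₂), χ ⟨x, mem_sup_right hx⟩ = χ₂ ⟨x, hx⟩) := by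
  classical
  let Y : (H₁ ⊔ H₂ : Subgroup G) → G := fun x => (mem_sup.mp x.2).choose
  have hY : ∀ x, Y x ∈ H₁ := fun x => (mem_sup.mp x.2).choose_spec.1
  let Z : (H₁ ⊔ H₂ : Subgroup G) → G := fun x => (mem_sup.mp x.2).choose_spec.2.choose
  have hZ : ∀ x, Z x ∈ H₂ := fun x => (mem_sup.mp x.2).choose_spec.2.choose_spec.1
  have hYZ : ∀ x, Y x * Z x = x := fun x => (mem_sup.mp x.2).choose_spec.2.choose_spec.2
  refine ⟨{ toFun := fun x => χ₁ ⟨Y x, hY x⟩ * χ₂ ⟨Z x, hZ x⟩, map_one' := ?_, map_mul' := ?_ },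
    ?_, ?_⟩
  · have e := glue_wd χ₁ χ₂ h (hY 1) H₁.one_mem (hZ 1) H₂.one_mem (by rw [hYZ, one_mul]; rfl)
    rw [e]
    show χ₁ 1 * χ₂ 1 = 1
    rw [map_one, map_one, one_mul]
  · intro a b
    have e := glue_wd χ₁ χ₂ h (hY (a * b)) (mul_mem (hY a) (hY b)) (hZ (a * b))
      (mul_mem (hZ a) (hZ b)) (by
        rw [hYZ, mul_mul_mul_comm, hYZ, hYZ]; rfl)
    show χ₁ ⟨Y (a * b), _⟩ * χ₂ ⟨Z (a * b), _⟩ =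
      χ₁ ⟨Y a, hY a⟩ * χ₂ ⟨Z a, hZ a⟩ * (χ₁ ⟨Y b, hY b⟩ * χ₂ ⟨Z b, hZ b⟩)
    rw [e]
    have e1 : (⟨Y a * Y b, mul_mem (hY a) (hY b)⟩ : H₁) = ⟨Y a, hY a⟩ * ⟨Y b, hY b⟩ := rfl
    have e2 : (⟨Z a * Z b, mul_mem (hZ a) (hZ b)⟩ : H₂) = ⟨Z a, hZ a⟩ * ⟨Z b, hZ b⟩ := rfl
    rw [e1, e2, map_mul, map_mul, mul_mul_mul_comm]
  · intro x hx
    show χ₁ ⟨Y _, hY _⟩ * χ₂ ⟨Z _, hZ _⟩ = χ₁ ⟨x, hx⟩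
    rw [glue_wd χ₁ χ₂ h (hY _) hx (hZ _) H₂.one_mem (by rw [hYZ, mul_one])]
    show χ₁ ⟨x, hx⟩ * χ₂ 1 = χ₁ ⟨x, hx⟩
    rw [map_one, mul_one]
  · intro x hx
    show χ₁ ⟨Y _, hY _⟩ * χ₂ ⟨Z _, hZ _⟩ = χ₂ ⟨x, hx⟩
    rw [glue_wd χ₁ χ₂ h (hY _) H₁.one_mem (hZ _) hx (by rw [hYZ, one_mul])]
    show χ₁ 1 * χ₂ ⟨x, hx⟩ = χ₂ ⟨x, hx⟩
    rw [map_one, one_mul]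

/-- Uniqueness of the glued character. -/
theorem monoidHom_sup_ext {χ χ' : (H₁ ⊔ H₂ : Subgroup G) →* M}
    (h1 : ∀ (x : G) (hx : x ∈ H₁), χ ⟨x, mem_sup_left hx⟩ = χ' ⟨x, mem_sup_left hx⟩)
    (h2 : ∀ (x : G) (hx : x ∈ H₂), χ ⟨x, mem_sup_right hx⟩ = χ' ⟨x, mem_sup_right hx⟩) :
    χ = χ' := by
  ext ⟨x, hx⟩
  obtain ⟨y, hy, z, hz, rfl⟩ := mem_sup.mp hx
  have : (⟨y * z, hx⟩ : (H₁ ⊔ H₂ : Subgroup G)) = ⟨y, mem_sup_left hy⟩ * ⟨z, mem_sup_right hz⟩ :=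
    rfl
  rw [this, map_mul, map_mul, h1 y hy, h2 z hz]

end Subgroup

/-! ## Instance shape over `C_K` -/

namespace NumberField

variable (K : Type*) [Field K] [NumberField K]

/-- **N15, well-definedness of `χ_B` (compatibility (∞)).**  For any subgroup `H ≤ C_K` with a
character `χ₁` and an ∞-type `e` such that `χ₁` agrees with the ∞-type character on `H ⊓ [K_∞^×]`,
there is a character of `B := H ⊔ [K_∞^×]` extending `χ₁` and of ∞-type `e` on `K_∞^×`. -/
theorem exists_char_sup_infUnits_of_compatible (H : Subgroup (IdeleClassGroup K))
    (χ₁ : H →* Circle) (e : InfinitePlace K → ℤ)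
    (hcompat : ∀ (u : (InfiniteAdeleRing K)ˣ) (hu : infUnitsToClass K u ∈ H),
      χ₁ ⟨infUnitsToClass K u, hu⟩ = infinityTypeChar K e u) :
    ∃ χ : (H ⊔ (infUnitsToClass K).range : Subgroup (IdeleClassGroup K)) →* Circle,
      (∀ (x : IdeleClassGroup K) (hx : x ∈ H), χ ⟨x, Subgroup.mem_sup_left hx⟩ = χ₁ ⟨x, hx⟩) ∧
      (∀ u : (InfiniteAdeleRing K)ˣ,
        χ ⟨infUnitsToClass K u, Subgroup.mem_sup_right ⟨u, rfl⟩⟩ = infinityTypeChar K e u) := by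
  -- the ∞-type character kills `ker [K_∞^× → C_K]` (take `hu : 1 ∈ H` in `hcompat`)
  have hker : ∀ u : (InfiniteAdeleRing K)ˣ, infUnitsToClass K u = 1 → infinityTypeChar K e u = 1 := by
    intro u hu
    have h1 : infUnitsToClass K u ∈ H := by rw [hu]; exact H.one_mem
    rw [← hcompat u h1]
    have : (⟨infUnitsToClass K u, h1⟩ : H) = 1 := Subtype.ext hu
    rw [this, map_one]
  obtain ⟨χ₂, hχ₂⟩ := MonoidHom.exists_range_factor (infUnitsToClass K) (infinityTypeChar K e) hker
  have hagree : ∀ (x : IdeleClassGroup K) (h1 : x ∈ H) (h2 : x ∈ (infUnitsToClass K).range),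
      χ₁ ⟨x, h1⟩ = χ₂ ⟨x, h2⟩ := by
    rintro _ h1 ⟨u, rfl⟩
    rw [hcompat u h1, ← hχ₂ u]
  obtain ⟨χ, hχ1, hχ2⟩ :=
    Subgroup.exists_monoidHom_sup_extends (G := IdeleClassGroup K) (M := Circle) (H₁ := H)
      (H₂ := (infUnitsToClass K).range) χ₁ χ₂ hagree
  exact ⟨χ, hχ1, fun u => by rw [hχ2 _ ⟨u, rfl⟩, hχ₂]⟩

/-- **N15 from the compatibility (∞) plus continuity of the glued character.**  If, in the situation
of `exists_char_sup_infUnits_of_compatible`, the glued character of `B = H ⊔ [K_∞^×]` is continuous,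
then `χ₁` is the restriction of a unitary Hecke character of ∞-type `e`. -/
theorem exists_unitaryHeckeCharacter_of_compatible (H : Subgroup (IdeleClassGroup K))
    (χ₁ : H →* Circle) (e : InfinitePlace K → ℤ)
    (hcompat : ∀ (u : (InfiniteAdeleRing K)ˣ) (hu : infUnitsToClass K u ∈ H),
      χ₁ ⟨infUnitsToClass K u, hu⟩ = infinityTypeChar K e u)
    (hcont : ∀ χ : (H ⊔ (infUnitsToClass K).range : Subgroup (IdeleClassGroup K)) →* Circle,
      (∀ (x : IdeleClassGroup K) (hx : x ∈ H), χ ⟨x, Subgroup.mem_sup_left hx⟩ = χ₁ ⟨x, hx⟩) →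
      (∀ u : (InfiniteAdeleRing K)ˣ,
        χ ⟨infUnitsToClass K u, Subgroup.mem_sup_right ⟨u, rfl⟩⟩ = infinityTypeChar K e u) →
      Continuous χ) :
    ∃ ψ : UnitaryHeckeCharacter K,
      ψ.HasInfinityType K e ∧ ∀ (x : IdeleClassGroup K) (hx : x ∈ H), ψ x = χ₁ ⟨x, hx⟩ := by
  obtain ⟨χ, hχ1, hχ2⟩ := exists_char_sup_infUnits_of_compatible K H χ₁ e hcompat
  have hB : ∀ u : (InfiniteAdeleRing K)ˣ,
      infUnitsToClass K u ∈ (H ⊔ (infUnitsToClass K).range : Subgroup (IdeleClassGroup K)) :=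
    fun u => Subgroup.mem_sup_right ⟨u, rfl⟩
  obtain ⟨ψ, hψe, hψ⟩ := exists_unitaryHeckeCharacter_of_infinityType K _ hB χ
    (hcont χ hχ1 hχ2) e hχ2
  exact ⟨ψ, hψe, fun x hx => by rw [← hχ1 x hx]; exact hψ ⟨x, Subgroup.mem_sup_left hx⟩⟩

end NumberField

end
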